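import Literature.MathematicalPhysics.StatisticalMechanics.Theil2006ReferenceRigidity
import Literature.MathematicalPhysics.StatisticalMechanics.Theil2006ChartExtension
import Literature.MathematicalPhysics.StatisticalMechanics.Theil2006RealizedWalks
import HarnessLib

/-!
# Theil 2006, Appendix Proposition 4.8 (1)–(2): existence of a discrete imbedding of a
defect-free disc satisfying the rigidity estimate (61) — proved

Topic `Literature/MathematicalPhysics/StatisticalMechanics`; companion of `Theil2006.lean`
(F. Theil, *A proof of crystallization in two dimensions*, Comm. Math. Phys. **262** (2006)
209–236, accepted preprint of 26 Aug 2005), Appendix §4.2, Proposition 4.8 (p. 21).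

## Source, as printed, and what this file proves

Proposition 4.8: «Let `Ω ⊂ ℝ²` be simply connected, `R > 2 + 2√3` … such that
`B_R(x̄) ∩ y(∂X) = ∅` … Then there exists a discrete imbedding `Φ : y⁻¹(Ω) → A₂`» with (60),
(61) `| |Φ(x) − Φ(x′)| / |y(x) − y(x′)| − 1 | ≤ Cα` and (62). This file proves the existence
assertion together with (61) in the ball form in which the main theorems consume it
(`Theil2006_mainTheorems_of_existsRigidReference`, hypothesis (H48′)):

* `Theil2006_existsRigidReference` — there are `α₀ > 0` and `K ≥ 0` such that for
  `0 < α < α₀`, every finite configuration with (13), every disc `B(c, r)` with `r ≥ 2` and no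
  defect within `R ≥ 4r + 2` of `c` admits `Φ : X_N → ℤ²` which is a discrete imbedding of
  `y⁻¹(B(c, r))` and satisfies (61) there.

Proof (pp. 20–21 of the print, reorganised): the label map `Φ` is the continuation of the local
charts of Lemma 4.7 over the disc (`Theil2006.exists_charted`, induction on the distance to the
centre instead of the path sums (64)); injectivity in the large is the path independence of
realized lattice walks (`Theil2006.isDiscreteImbeddingOn_reach`, from the simple connectivity of
label balls, `Theil2006.WalkEquiv` — the combinatorial Lemma 4.6); the particles of the disc are
reached by bond chains descending the distance to the centre (`exists_chain_of_dist_lt`, from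
`IsHexagonalNbhd.exists_dist_sq_le`); (61) is `Theil2006.chart_rigidity` (upper half from the
local charts, lower half from the realized label segment). All constants are explicit; the
radii bookkeeping (`4r + 2 ≤ R`, `r ≥ 2`) is ours.
[cite: Theil2006, §4.2 Proposition 4.8 (1)–(2) and its proof (preprint pp. 20–21, 23)]
-/

namespace Literature.MathematicalPhysics.StatisticalMechanics

namespace Theil2006

open Metric Set

universe u

section Chains

variable {X : Type*} {α : ℝ} {y : X → Plane} {Φ : X → ℤ × ℤ}

/-- Appending one step to a bond chain. [folklore] -/
private theorem isChain_append_singleton {R : X → X → Prop} {q : X} {ps : List X} {x : X}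
    (hc : List.IsChain R (q :: ps)) (hx : R (chainEnd q ps) x) :
    List.IsChain R (q :: (ps ++ [x])) := by
  induction ps generalizing q with
  | nil =>
    rw [List.nil_append, List.isChain_cons_cons]
    exact ⟨hx, List.isChain_singleton _⟩
  | cons b ps ih =>
    rw [List.isChain_cons_cons] at hc
    rw [List.cons_append, List.isChain_cons_cons]
    exact ⟨hc.1, ih hc.2 hx⟩

/-- The endpoint after appending one step. [folklore] -/
private theorem chainEnd_append_singleton (q : X) (ps : List X) (x : X) :
    chainEnd q (ps ++ [x]) = x := by
  induction ps generalizing q with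
  | nil => rfl
  | cons b ps ih => exact ih b

/-- **Descending bond chains.** In a charted region of radius `ρ` around `y(p₀)` (`(13)`,
`0 < α ≤ 1/200`), every particle `x` of the region is the endpoint of a bond chain from `p₀`
through charted particles, all of which are no farther from `y(p₀)` than `y(x)`: step from `x` to
the neighbour that is strictly closer to `y(p₀)` (`IsHexagonalNbhd.exists_dist_sq_le`) and
recurse. [cite: Theil2006, §4.2 proof of Proposition 4.8 («Let γ_x … be a discrete path such
that … γ_x(K_x) = x», preprint p. 21); our lemma] -/
theorem exists_chain_of_dist_lt (hα : 0 < α) (hα' : α ≤ 1 / 200)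
    (hsep : ∀ x x' : X, x ≠ x' → 1 - α < dist (y x) (y x')) {p₀ : X} {ρ : ℝ}
    (hS : ∀ b, dist (y b) (y p₀) < ρ → IsCharted α y Φ b) {x : X}
    (hx : dist (y x) (y p₀) < ρ) :
    ∃ ps : List X, List.IsChain (ChartedStep α y Φ) (p₀ :: ps) ∧ chainEnd p₀ ps = x ∧
      ∀ b ∈ ps, dist (y b) (y p₀) ≤ dist (y x) (y p₀) := by
  -- induction on `n` with `2 |y(x) − y(p₀)|² < n`
  suffices h : ∀ (n : ℕ) (x : X), dist (y x) (y p₀) < ρ → 2 * dist (y x) (y p₀) ^ 2 < n →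
      ∃ ps : List X, List.IsChain (ChartedStep α y Φ) (p₀ :: ps) ∧ chainEnd p₀ ps = x ∧
        ∀ b ∈ ps, dist (y b) (y p₀) ≤ dist (y x) (y p₀) by
    obtain ⟨n, hn⟩ := exists_nat_gt (2 * dist (y x) (y p₀) ^ 2)
    exact h n x hx hn
  intro n
  induction n with
  | zero => intro x _ hn; simp at hn; nlinarith [sq_nonneg (dist (y x) (y p₀))]
  | succ n ih =>
    intro x hxρ hn
    by_cases hx0 : x = p₀
    · subst hx0
      exact ⟨[], List.isChain_singleton _, rfl, fun b hb => by simp at hb⟩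
    · have hd : 1 - α < dist (y x) (y p₀) := hsep x p₀ hx0
      obtain ⟨⟨p, H⟩, -⟩ := hS x hxρ
      obtain ⟨i, -, hi⟩ := H.exists_dist_sq_le hα hα' (y p₀)
      set d := dist (y x) (y p₀) with hd_def
      have hdec : dist (y (p i)) (y p₀) ^ 2 ≤ d ^ 2 - 1 / 2 := by nlinarith
      have hlt : dist (y (p i)) (y p₀) < d := by
        by_contra hle
        rw [not_lt] at hle
        nlinarith [dist_nonneg (x := y (p i)) (y := y p₀)]
      obtain ⟨ps, hc, hend, hle⟩ := ih (p i) (hlt.trans hxρ) (by push_cast at hn ⊢; nlinarith)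
      refine ⟨ps ++ [x], isChain_append_singleton hc ?_, chainEnd_append_singleton _ _ _, ?_⟩
      · rw [hend]
        exact ⟨hS _ (hlt.trans hxρ), (H.isShortRange_centre i).symm⟩
      · intro b hb
        rw [List.mem_append, List.mem_singleton] at hb
        rcases hb with hb | rfl
        · exact (hle b hb).trans hlt.le
        · exact le_rfl

end Chains

section Geometry

variable {X : Type*} {α : ℝ} {y : X → Plane}

/-- A point of the closed triangle spanned by a unit simplex is within `1 + α` of each vertex.
[cite: Theil2006, §2.3 Definition 2.6 (preprint p. 8); our bookkeeping] -/
theorem dist_le_of_mem_convexHull_simplex (hα : 0 ≤ α) {T : Finset X}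
    (hT : IsEquilateralSimplex α y 1 T) {a : X} (ha : a ∈ T) {f : Plane}
    (hf : f ∈ convexHull ℝ (y '' ↑T)) : dist f (y a) ≤ 1 + α := by
  have hsr := (isEquilateralSimplex_one_iff.1 hT).2
  have hsub : y '' ↑T ⊆ closedBall (y a) (1 + α) := by
    rintro _ ⟨b, hb, rfl⟩
    rw [mem_closedBall]
    by_cases hab : a = b
    · subst hab; rw [dist_self]; linarith
    · rw [dist_comm]; exact (hsr a ha b hb hab).dist_le
  exact convexHull_min hsub (convex_closedBall _ _) hf

/-- `2/√3 ≤ 1.155`. [folklore] -/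
private theorem two_div_sqrt_three_le' : 2 / √3 ≤ 1155 / 1000 := by
  have h3 : (0 : ℝ) < √3 := Real.sqrt_pos.2 (by norm_num)
  have hsq : (√3 : ℝ) ^ 2 = 3 := Real.sq_sqrt (by norm_num)
  rw [div_le_iff₀ h3]
  nlinarith

/-- **Graph norm versus Euclidean norm**: `hexNorm(v) ≤ (2/√3)|v| ≤ 1.155 |v|` (in lattice
coordinates `4|v|² = 4(a² + ab + b²) ≥ 3 max(a², b², (a + b)²)`). [cite: Theil2006, §4.2 proof of Proposition 4.8 (3) («n ≤ (2/√3)|η − Φ(x)|», preprint p. 21)] -/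
theorem hexNorm_le_norm_triPoint (v : ℤ × ℤ) : (hexNorm v : ℝ) ≤ 1155 / 1000 * ‖triPoint v‖ := by
  have hsq := norm_triPoint_sq v
  have hn0 : 0 ≤ ‖triPoint v‖ := norm_nonneg _
  -- `3 h² ≤ 4 |v|²` with `h = hexNorm v`
  have key : 3 * (hexNorm v : ℝ) ^ 2 ≤ 4 * ‖triPoint v‖ ^ 2 := by
    rw [hsq]
    have h1 : (3 : ℤ) * (hexNorm v : ℤ) ^ 2 ≤ 4 * (v.1 ^ 2 + v.1 * v.2 + v.2 ^ 2) := by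
      have e : (hexNorm v : ℤ) = max (max |v.1| |v.2|) |v.1 + v.2| := by
        simp [hexNorm]
      rw [e]
      have hA : max (max |v.1| |v.2|) |v.1 + v.2| = |v.1| ∨ max (max |v.1| |v.2|) |v.1 + v.2| = |v.2| ∨
          max (max |v.1| |v.2|) |v.1 + v.2| = |v.1 + v.2| := by
        rcases le_total (max |v.1| |v.2|) |v.1 + v.2| with h | h
        · right; right; exact max_eq_right h
        · rw [max_eq_left h]
          rcases le_total |v.1| |v.2| with h' | h'
          · right; left; exact max_eq_right h'
          · left; exact max_eq_left h'
      rcases hA with h | h | h <;> rw [h, sq_abs] <;>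
        nlinarith [sq_nonneg (2 * v.2 + v.1), sq_nonneg (2 * v.1 + v.2), sq_nonneg (v.1 - v.2)]
    exact_mod_cast h1
  have h0 : 0 ≤ (hexNorm v : ℝ) := Nat.cast_nonneg _
  -- `h ≤ (2/√3)|v| ≤ 1.155|v|`
  by_contra hcon
  rw [not_le] at hcon
  nlinarith

end Geometry

section Main

/-- Membership in the tree's finset `defects` is membership in `∂X(y)`. [cite: Theil2006, §2.1 (preprint p. 4)] -/
private theorem mem_defects_iff {N : ℕ} {α : ℝ} {y : Fin N → Plane} {b : Fin N} :
    b ∈ defects α y ↔ b ∈ defectSet α y := by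
  rw [← Finset.mem_coe, coe_defects]

end Main

end Theil2006

open Theil2006 Metric Set in
/-- **Theil 2006, Proposition 4.8 (1)–(2), existence with (61), ball form — proved.** There are
`α₀ > 0` and `K ≥ 0` such that for `0 < α < α₀`, every finite configuration `y : X_N → ℝ²` with
(13), and every disc `B(c, r)`, `r ≥ 2`, with no defect within `R ≥ 4r + 2` of `c`, there is
`Φ : X_N → ℤ²` which is a discrete imbedding of `y⁻¹(B(c, r))` (Definition 2.4) and satisfies
(61) `| |Φ(x) − Φ(x′)| / |y(x) − y(x′)| − 1 | ≤ Kα` for all `x ≠ x′` in the disc. This is exactly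
hypothesis (H48′) of `Theil2006_mainTheorems_of_existsRigidReference`. Construction: local
charts (Lemma 4.7) continued over the disc (`exists_charted`), injective in the large by the
simple connectivity of label balls (Lemma 4.6, `isDiscreteImbeddingOn_reach`), rigid by
`chart_rigidity`. [cite: Theil2006, §4.2 Proposition 4.8 (1)–(2) (60)–(61) and its proof
(preprint pp. 20–21, 23); ball form and constants ours] -/
theorem Theil2006_existsRigidReference :
    ∃ α₀ K : ℝ, 0 < α₀ ∧ 0 ≤ K ∧ ∀ ⦃α : ℝ⦄, 0 < α → α < α₀ →
      ∀ {N : ℕ} (y : Fin N → Plane), (∀ i j : Fin N, i ≠ j → 1 - α < dist (y i) (y j)) →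
      ∀ (c : Plane) (r R : ℝ), 2 ≤ r → 4 * r + 2 ≤ R → (∀ b ∈ defects α y, R ≤ dist (y b) c) →
        ∃ Φ : Fin N → ℤ × ℤ, IsDiscreteImbeddingOn α y (y ⁻¹' ball c r) Φ ∧
          (∀ x x' : Fin N, y x ∈ ball c r → y x' ∈ ball c r → x ≠ x' →
            |dist (triPoint (Φ x)) (triPoint (Φ x')) / dist (y x) (y x') - 1| ≤ K * α) := by
  obtain ⟨K, α₁, hK, hα₁, hrig⟩ := chart_rigidity.{0}
  refine ⟨min α₁ (min (1 / 200) (1 / (1000 * K))), K,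
    lt_min hα₁ (lt_min (by norm_num) (by positivity)), hK.le, ?_⟩
  intro α hα hα₀ N y hsep c r R hr hR hdef
  have hαα₁ : α ≤ α₁ := (hα₀.trans_le (min_le_left _ _)).le
  have hα' : α ≤ 1 / 200 := (hα₀.trans_le ((min_le_right _ _).trans (min_le_left _ _))).le
  have hαK : α ≤ 1 / (1000 * K) :=
    (hα₀.trans_le ((min_le_right _ _).trans (min_le_right _ _))).le
  have hKα : K * α ≤ 1 / 1000 := by
    rw [le_div_iff₀ (by positivity)] at hαK; linarith
  have hα1 : α < 1 := by linarith
  have hKα0 : 0 ≤ K * α := by positivity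
  have hdefS : ∀ b ∈ defectSet α y, R ≤ dist (y b) c := fun b hb =>
    hdef b (mem_defects_iff.2 hb)
  by_cases hne : ∃ x₀, y x₀ ∈ ball c r
  swap
  · -- no particle in the disc: nothing to do
    push Not at hne
    refine ⟨fun _ => 0, ⟨fun x hx => absurd hx (hne x), fun x hx => absurd hx (hne x),
      fun x hx => absurd hx (hne x)⟩, fun x _ hx => absurd hx (hne x)⟩
  obtain ⟨x₀, hx₀⟩ := hne
  have hr0 : 0 < r := by linarith
  -- the base particle `p₀`, within `1 + α` of `c`
  obtain ⟨T, hT, -, hcT⟩ := exists_simplex_mem_convexHull_of_mem_ball hα hα' hsep (r := r)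
    (R := r + 2) le_rfl (fun b hb => by have := hdefS b hb; linarith) hx₀ (mem_ball_self hr0)
  obtain ⟨p₀, hp₀T⟩ : T.Nonempty := by
    rw [← Finset.card_pos, hT.card_eq_three]; norm_num
  have hδ : dist (y p₀) c ≤ 1 + α := by
    rw [dist_comm]; exact dist_le_of_mem_convexHull_simplex hα.le hT hp₀T hcT
  -- the label map: local charts over the disc of radius `ρ₀` about `y p₀`
  set ρ : ℝ := R - dist (y p₀) c - 2 - 2 * α with hρ_def
  have hρ : 4 * r - 1 - 3 * α ≤ ρ := by rw [hρ_def]; linarith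
  obtain ⟨Φ, hΦ⟩ := exists_charted hα hα' hsep p₀ (ρ₀ := ρ + 1 + α) (fun b hb hbd => by
    have h1 := hdefS b hbd
    have h2 : dist (y b) c ≤ dist (y b) (y p₀) + dist (y p₀) c := dist_triangle _ _ _
    rw [hρ_def] at hb
    linarith)
  have hS : ∀ b, dist (y b) (y p₀) < ρ → IsCharted α y Φ b := fun b hb =>
    hΦ b (by linarith)
  obtain ⟨hup, hlow⟩ := hrig hα hαα₁ hsep (Φ := Φ)
  -- the region where the upper half of (61) is available: `B(y p₀, r + 1 + α)`
  set r_u : ℝ := r + 1 + α with hru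
  have hdef_u : ∀ b ∈ defectSet α y, r_u + 2 ≤ dist (y b) (y p₀) := by
    intro b hb
    have h1 := hdefS b hb
    have h2 : dist (y b) c ≤ dist (y b) (y p₀) + dist (y p₀) c := dist_triangle _ _ _
    rw [hru]; linarith
  have hch_u : ∀ z, y z ∈ ball (y p₀) (r_u + 2) → IsDiscreteImbeddingOn α y (nbhdSet α y z) Φ :=
    fun z hz => (hS z (by rw [mem_ball] at hz; rw [hru] at hz; linarith)).2
  have hUP : ∀ {x x' : Fin N}, dist (y x) (y p₀) < r_u → dist (y x') (y p₀) < r_u →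
      dist (triPoint (Φ x)) (triPoint (Φ x')) ≤ (1 + K * α) * dist (y x) (y x') :=
    fun hx hx' => hup (le_refl (r_u + 2)) hdef_u hch_u (mem_ball.2 hx) (mem_ball.2 hx')
  have hp₀u : dist (y p₀) (y p₀) < r_u := by rw [dist_self, hru]; linarith
  -- Euclidean and graph bounds for the labels of the particles of `B(y p₀, r_u)`
  set B : ℝ := (1 + K * α) * r_u with hB
  have hB0 : 0 ≤ B := by rw [hB, hru]; positivity
  have hlabE : ∀ {b : Fin N}, dist (y b) (y p₀) < r_u → ‖triPoint (Φ b - Φ p₀)‖ ≤ B := by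
    intro b hb
    have h := hUP hb hp₀u
    rw [dist_triPoint] at h
    exact h.trans (mul_le_mul_of_nonneg_left hb.le (by positivity))
  set M : ℕ := ⌊1155 / 1000 * B⌋₊ with hM
  set nη : ℕ := ⌊1155 / 1000 * (B + 1 + α)⌋₊ with hnη
  have hMn : M ≤ nη := Nat.floor_le_floor (by nlinarith)
  have hlabM : ∀ {b : Fin N}, dist (y b) (y p₀) < r_u → hexNorm (Φ b - Φ p₀) ≤ M := by
    intro b hb
    refine Nat.le_floor ((hexNorm_le_norm_triPoint _).trans ?_)
    exact mul_le_mul_of_nonneg_left (hlabE hb) (by norm_num)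
  -- the radius bookkeeping: `(nη + 2)(1 + α) < ρ`
  have hbudget : ((nη : ℝ) + 1 + 1) * (1 + α) < ρ := by
    have h1 : (nη : ℝ) ≤ 1155 / 1000 * (B + 1 + α) := Nat.floor_le (by nlinarith)
    have h2 : B ≤ (1 + 1 / 1000) * (r + 1 + 1 / 200) := by
      rw [hB, hru]
      exact mul_le_mul (by linarith) (by linarith) (by linarith) (by norm_num)
    nlinarith
  have hnη1 : ((nη : ℝ) + 1) * (1 + α) < ρ := by nlinarith
  have hnω : (((nη + 1 : ℕ) : ℝ) + 1) * (1 + α) < ρ := by push_cast; linarith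
  have hρu : r_u ≤ ρ := by
    have h1 : (0 : ℝ) ≤ nη := Nat.cast_nonneg _
    rw [hru]; nlinarith
  -- the imbedded patch `ω = reach p₀ (nη + 1)` contains the disc
  set ω : Set (Fin N) := reach α y Φ p₀ (nη + 1) with hω
  have hDI : IsDiscreteImbeddingOn α y ω Φ := isDiscreteImbeddingOn_reach hS hα.le hα1 hnω
  have hmemω : ∀ {x : Fin N}, dist (y x) (y p₀) < r_u → x ∈ ω := by
    intro x hx
    obtain ⟨ps, hc, hend, hle⟩ := exists_chain_of_dist_lt hα hα' hsep hS (hx.trans_le hρu)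
    rw [← hend]
    exact reach_mono (hMn.trans (Nat.le_succ _))
      (chainEnd_mem_reach hα1 hc fun b hb => hlabM ((hle b hb).trans_lt hx))
  have hball_u : ∀ {x : Fin N}, y x ∈ ball c r → dist (y x) (y p₀) < r_u := by
    intro x hx
    rw [mem_ball] at hx
    calc dist (y x) (y p₀) ≤ dist (y x) c + dist c (y p₀) := dist_triangle _ _ _
      _ < r + (1 + α) := by rw [dist_comm c]; linarith
      _ = r_u := by rw [hru]; ring
  refine ⟨Φ, hDI.mono fun x hx => hmemω (hball_u hx), fun x x' hx hx' hxx' => ?_⟩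
  -- (61) for `x ≠ x'` in the disc
  have hxu := hball_u hx
  have hxu' := hball_u hx'
  have hUPx := hUP hxu hxu'
  have hLOW : dist (y x) (y x') ≤ (1 + K * α) * dist (triPoint (Φ x)) (triPoint (Φ x')) := by
    refine hlow hDI (hmemω hxu) (hmemω hxu') fun T hT ⟨f, hfT, hfseg⟩ η hη => ?_
    -- the vertex `η` is within `B + 1 + α` of `Φ p₀`
    have hf : dist f (triPoint (Φ p₀)) ≤ B := by
      have hseg : segment ℝ (triPoint (Φ x)) (triPoint (Φ x')) ⊆
          closedBall (triPoint (Φ p₀)) B := by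
        refine (convex_closedBall _ _).segment_subset ?_ ?_
        · rw [mem_closedBall, dist_triPoint]; exact hlabE hxu
        · rw [mem_closedBall, dist_triPoint]; exact hlabE hxu'
      exact mem_closedBall.1 (hseg hfseg)
    have hηf : dist f (triPoint η) ≤ 1 + α := dist_le_of_mem_convexHull_simplex hα.le hT hη hfT
    have hηn : hexNorm (η - Φ p₀) ≤ nη := by
      refine Nat.le_floor ((hexNorm_le_norm_triPoint _).trans ?_)
      refine mul_le_mul_of_nonneg_left ?_ (by norm_num)
      rw [← dist_triPoint]
      calc dist (triPoint η) (triPoint (Φ p₀)) ≤ dist (triPoint η) f + dist f (triPoint (Φ p₀)) :=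
            dist_triangle _ _ _
        _ ≤ (1 + α) + B := by rw [dist_comm]; exact add_le_add hηf hf
        _ = B + 1 + α := by ring
    obtain ⟨hΦp, hpdef, hNp⟩ := realize_outWalk_spec hS hα.le hα1 hnη1 hηn
    exact ⟨_, reach_mono (Nat.le_succ _) (realize_outWalk_mem_reach hηn), hΦp, hpdef, hNp⟩
  -- quotient form
  have hd : 0 < dist (y x) (y x') := by have := hsep x x' hxx'; linarith
  set D := dist (triPoint (Φ x)) (triPoint (Φ x')) with hD
  have hD0 : 0 ≤ D := dist_nonneg
  rw [abs_le]
  constructor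
  · -- `D/d ≥ 1/(1 + Kα) ≥ 1 − Kα`
    rw [le_sub_iff_add_le, le_div_iff₀ hd]
    nlinarith [mul_nonneg hKα0 hD0]
  · rw [sub_le_iff_le_add, div_le_iff₀ hd]
    linarith


end Literature.MathematicalPhysics.StatisticalMechanics
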